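import Mathlib.Analysis.InnerProductSpace.Basic
import HarnessLib

/-!
# The alignment inequality for the axes of overlapping necks (linear algebra)

Elementary real inner-product-space inequalities behind the comparison of the axes of two
overlapping `ε`-necks through the kernel of the Ricci tensor (R. Hamilton, Comm. Anal. Geom. 5
(1997), §C2, p. 31: on the overlap both neck structures see the same Ricci tensor of `g`, whose
kernel is `ε`-close to either axis). The model Ricci form of the round cylinder in conformally
flat coordinates at a point `y ≠ 0` is `λ (‖u‖² − ⟪y,u⟫²/‖y‖²)` on the diagonal
(`Lorentzian/CoordCylinderRicci.lean`, `MetricCoord.ricAt_cyl_self`, `λ = (n−2)/‖y‖²`), vanishing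
exactly in the radial (= axial) direction. If a quadratic form `B` is `η`-close to the model at
`x` (so `B(x,x) ≤ η‖x‖²`), and through a linear map `T` (the differential of the transition map)
`B(x,x) = B₁(Tx,Tx)` with `B₁` `η`-close to the model at `y`, then `u = Tx` is almost radial at
`y`: `⟪y,u⟫²/‖y‖² ≥ ‖u‖² − (η/λ)(‖x‖² + ‖u‖²)` (`inner_sq_div_ge_of_necks`), hence `⟪y, Tx⟫ ≠ 0`
as soon as `‖Tx‖ ≥ μ‖x‖` and `η/λ < μ²/(1+μ²)` (`inner_ne_zero_of_necks`) — the transition map is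
monotone along the axes. Everything is proved; no definitions, no named facts.

## References

* R. S. Hamilton, *Four-manifolds with positive isotropic curvature*, Comm. Anal. Geom. 5 (1997),
  §C2, p. 31. [Hamilton1997]
-/

open scoped RealInnerProductSpace

namespace Literature.Geometry.Riemannian

namespace NeckAlignment

variable {F : Type*} [NormedAddCommGroup F] [InnerProductSpace ℝ F]

/-- **Transfer of the axial defect.** If `B(x,x) ≤ η‖x‖²` (closeness to a model form vanishing on
`x`), `B(x,x) = B₁(u,u)` and `|B₁(u,u) − λ(‖u‖² − ⟪y,u⟫²/‖y‖²)| ≤ η‖u‖²`, then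
`λ (‖u‖² − ⟪y,u⟫²/‖y‖²) ≤ η (‖x‖² + ‖u‖²)`. [cite: Hamilton1997, §C2] -/
theorem model_defect_le {x y u : F} {Bxx B₁uu lam eta : ℝ} (hB : Bxx ≤ eta * ‖x‖ ^ 2)
    (hBT : Bxx = B₁uu)
    (hB₁ : |B₁uu - lam * (‖u‖ ^ 2 - (‖y‖ ^ 2)⁻¹ * ⟪y, u⟫ ^ 2)| ≤ eta * ‖u‖ ^ 2) :
    lam * (‖u‖ ^ 2 - (‖y‖ ^ 2)⁻¹ * ⟪y, u⟫ ^ 2) ≤ eta * (‖x‖ ^ 2 + ‖u‖ ^ 2) := by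
  have h1 := (abs_le.1 hB₁).1
  rw [← hBT] at h1
  nlinarith [h1, hB]

/-- **The alignment inequality**: under `λ (‖u‖² − ⟪y,u⟫²/‖y‖²) ≤ η (‖x‖² + ‖u‖²)` with `λ > 0`,
`⟪y,u⟫²/‖y‖² ≥ ‖u‖² − (η/λ)(‖x‖² + ‖u‖²)`. [cite: Hamilton1997, §C2] -/
theorem inner_sq_div_ge {x y u : F} {lam eta : ℝ} (hlam : 0 < lam)
    (h : lam * (‖u‖ ^ 2 - (‖y‖ ^ 2)⁻¹ * ⟪y, u⟫ ^ 2) ≤ eta * (‖x‖ ^ 2 + ‖u‖ ^ 2)) :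
    ‖u‖ ^ 2 - eta / lam * (‖x‖ ^ 2 + ‖u‖ ^ 2) ≤ (‖y‖ ^ 2)⁻¹ * ⟪y, u⟫ ^ 2 := by
  have h' : ‖u‖ ^ 2 - (‖y‖ ^ 2)⁻¹ * ⟪y, u⟫ ^ 2 ≤ eta / lam * (‖x‖ ^ 2 + ‖u‖ ^ 2) := by
    rw [div_mul_eq_mul_div, le_div_iff₀ hlam]
    linarith
  linarith

/-- Combination of the two: from the neck-closeness hypotheses at `x` and `y`,
`⟪y,u⟫²/‖y‖² ≥ ‖u‖² − (η/λ)(‖x‖² + ‖u‖²)`. [cite: Hamilton1997, §C2] -/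
theorem inner_sq_div_ge_of_necks {x y u : F} {Bxx B₁uu lam eta : ℝ} (hlam : 0 < lam)
    (hB : Bxx ≤ eta * ‖x‖ ^ 2) (hBT : Bxx = B₁uu)
    (hB₁ : |B₁uu - lam * (‖u‖ ^ 2 - (‖y‖ ^ 2)⁻¹ * ⟪y, u⟫ ^ 2)| ≤ eta * ‖u‖ ^ 2) :
    ‖u‖ ^ 2 - eta / lam * (‖x‖ ^ 2 + ‖u‖ ^ 2) ≤ (‖y‖ ^ 2)⁻¹ * ⟪y, u⟫ ^ 2 :=
  inner_sq_div_ge hlam (model_defect_le hB hBT hB₁)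

/-- **Quantitative axiality**: if moreover `‖u‖ ≥ μ‖x‖` (`μ > 0`, the transition map does not
contract the axial direction too much) and `η/λ ≤ ε` with `ε (1 + μ²) < μ²` (the necks are fine
enough), then `⟪y,u⟫² ≥ (μ²(1−ε) − ε) ‖x‖² ‖y‖²` with a positive constant. [cite: Hamilton1997, §C2] -/
theorem inner_sq_ge_of_necks {x y u : F} {lam eta eps mu : ℝ} (hlam : 0 < lam) (heta : 0 ≤ eta)
    (h : lam * (‖u‖ ^ 2 - (‖y‖ ^ 2)⁻¹ * ⟪y, u⟫ ^ 2) ≤ eta * (‖x‖ ^ 2 + ‖u‖ ^ 2))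
    (hmu : mu * ‖x‖ ≤ ‖u‖) (hmu0 : 0 ≤ mu) (heps : eta / lam ≤ eps) (heps1 : eps ≤ 1) :
    (mu ^ 2 * (1 - eps) - eps) * ‖x‖ ^ 2 * ‖y‖ ^ 2 ≤ ⟪y, u⟫ ^ 2 := by
  have hkey := inner_sq_div_ge hlam h
  have hel : 0 ≤ eta / lam := div_nonneg heta hlam.le
  -- replace `η/λ` by `ε`
  have h2 : ‖u‖ ^ 2 - eps * (‖x‖ ^ 2 + ‖u‖ ^ 2) ≤ (‖y‖ ^ 2)⁻¹ * ⟪y, u⟫ ^ 2 := by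
    have : eta / lam * (‖x‖ ^ 2 + ‖u‖ ^ 2) ≤ eps * (‖x‖ ^ 2 + ‖u‖ ^ 2) :=
      mul_le_mul_of_nonneg_right heps (by positivity)
    linarith
  -- `‖u‖² (1 − ε) ≥ μ² ‖x‖² (1 − ε)`
  have hmu2 : mu ^ 2 * ‖x‖ ^ 2 ≤ ‖u‖ ^ 2 := by
    have := mul_self_le_mul_self (by positivity) hmu
    nlinarith [this]
  have h3 : (mu ^ 2 * (1 - eps) - eps) * ‖x‖ ^ 2 ≤ (‖y‖ ^ 2)⁻¹ * ⟪y, u⟫ ^ 2 := by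
    nlinarith [h2, hmu2, heps1]
  rcases eq_or_ne y 0 with rfl | hy
  · simp only [norm_zero, inner_zero_left]
    nlinarith [sq_nonneg (mu * ‖x‖), sq_nonneg ‖x‖]
  · have hy2 : 0 < ‖y‖ ^ 2 := by positivity
    have := mul_le_mul_of_nonneg_right h3 hy2.le
    have hr : (‖y‖ ^ 2)⁻¹ * ⟪y, u⟫ ^ 2 * ‖y‖ ^ 2 = ⟪y, u⟫ ^ 2 := by
      field_simp
    calc (mu ^ 2 * (1 - eps) - eps) * ‖x‖ ^ 2 * ‖y‖ ^ 2
        ≤ (‖y‖ ^ 2)⁻¹ * ⟪y, u⟫ ^ 2 * ‖y‖ ^ 2 := this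
      _ = ⟪y, u⟫ ^ 2 := hr

/-- **The transition map is transverse to the spheres**: under the hypotheses of
`inner_sq_ge_of_necks` with `ε (1 + μ²) < μ²` and `x, y ≠ 0`, `⟪y, u⟫ ≠ 0`.
[cite: Hamilton1997, §C2] -/
theorem inner_ne_zero_of_necks {x y u : F} {lam eta eps mu : ℝ} (hlam : 0 < lam) (heta : 0 ≤ eta)
    (h : lam * (‖u‖ ^ 2 - (‖y‖ ^ 2)⁻¹ * ⟪y, u⟫ ^ 2) ≤ eta * (‖x‖ ^ 2 + ‖u‖ ^ 2))
    (hmu : mu * ‖x‖ ≤ ‖u‖) (hmu0 : 0 ≤ mu) (heps : eta / lam ≤ eps)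
    (hfine : eps * (1 + mu ^ 2) < mu ^ 2) (hx : x ≠ 0) (hy : y ≠ 0) : ⟪y, u⟫ ≠ 0 := by
  have heps1 : eps ≤ 1 := by nlinarith [sq_nonneg mu]
  have hpos : 0 < mu ^ 2 * (1 - eps) - eps := by nlinarith
  have hb := inner_sq_ge_of_necks hlam heta h hmu hmu0 heps heps1
  intro h0
  rw [h0] at hb
  have : 0 < (mu ^ 2 * (1 - eps) - eps) * ‖x‖ ^ 2 * ‖y‖ ^ 2 := by
    have hx2 : 0 < ‖x‖ ^ 2 := by positivity
    have hy2 : 0 < ‖y‖ ^ 2 := by positivity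
    positivity
  nlinarith

end NeckAlignment

end Literature.Geometry.Riemannian
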